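import Summits.HodgeConjecture.HodgeConjecture.Theorems.F0P3bQCMTSignedOfSteinberg
import Summits.HodgeConjecture.HodgeConjecture.Theorems.F0P3cStCharTSOfQuasiSplitTransfer
import Literature.NumberTheory.Automorphic.IrreducibleClassesUnitarizable
import Literature.NumberTheory.Rogawski1990.LocalTransferExplicitNonsplit
import Literature.NumberTheory.Rogawski1990.LocalTransferExistence
import Summits.HodgeConjecture.HodgeConjecture.Theorems.F0P3cStCharTSEllComposeLB
import Summits.HodgeConjecture.HodgeConjecture.Theorems.F0P3cStCharTSSgnCompose
import Summits.HodgeConjecture.HodgeConjecture.Theorems.F0P3cStCharTSSaHead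
import Summits.HodgeConjecture.HodgeConjecture.Theorems.F0P3cStCharTSSaHeadTorus
import Summits.HodgeConjecture.HodgeConjecture.Theorems.F0P3cStCharTSSaHeadTorus2
import Summits.HodgeConjecture.HodgeConjecture.Theorems.F0P3cStCharTSSaHeadTorus3
import Summits.HodgeConjecture.HodgeConjecture.Theorems.F0P3cStCharTSSaHeadTorus4
import Summits.HodgeConjecture.HodgeConjecture.Theorems.F0P3cStCharTSSaHeadTorus6
import Summits.HodgeConjecture.HodgeConjecture.Theorems.F0P3cStCharTSSaHeadTorus7
import Summits.HodgeConjecture.HodgeConjecture.Theorems.F0P3cStCharTSSaHeadTorus8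
import Summits.HodgeConjecture.HodgeConjecture.Theorems.F0P3cStCharTSSaHeadTorus10LB
import Summits.HodgeConjecture.HodgeConjecture.Theorems.F0P3cStCharTSClassFn
import Summits.HodgeConjecture.HodgeConjecture.Theorems.F0P3cStCharTSSocketsOut
import Summits.HodgeConjecture.HodgeConjecture.Theorems.F0P3cStCharTSLdsuOut
import Summits.HodgeConjecture.HodgeConjecture.Theorems.F0P3cStCharTSEllOut
import Summits.HodgeConjecture.HodgeConjecture.Theorems.F0P3cStCharTSMateUniqOut
import Summits.HodgeConjecture.HodgeConjecture.Theorems.F0P3cStCharTSL2dEll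
import Summits.HodgeConjecture.HodgeConjecture.Theorems.F0P3cStCharTSPctOut
import Summits.HodgeConjecture.HodgeConjecture.Theorems.F0P3cStCharTSDatumJunction17
import Summits.HodgeConjecture.HodgeConjecture.Theorems.F0P3cStCharTSRung0TwentyTwo
import Summits.HodgeConjecture.HodgeConjecture.Theorems.F0P3cStCharTSNoncuspidalOfXIGEx
import Summits.HodgeConjecture.HodgeConjecture.Theorems.F0P3cStCharTSCuspidalOfXIG
import Summits.HodgeConjecture.HodgeConjecture.Theorems.F0P3cStCharTSMembersOfXIGPkg
import Summits.HodgeConjecture.HodgeConjecture.Theorems.F0P3cStCharTSXIGAssembly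
import Summits.HodgeConjecture.HodgeConjecture.Theorems.F0P3SpectralPacketUnitarizableByOccurrence
import HarnessLib

/-!
# K2·E1 — DEFS LEAF of the line `K2_E1_TraceFormulaBeta` (R6 (i): ONE defs leaf per engine; defs only, sorry-free, no instance∕notation∕axiom)

Holds, byte-identically and in the SAME namespace `Summit.HodgeConjecture.HodgeConjecture.Cruxes.H413.K2E1TraceFormulaBeta`, every definition named by the
tier-0 head `stub_E1_St1383 : E1St1383Letter` or by a tier-1 `sig_K2E1*` socket: `StSpectralHypLetter` (the letter (S-β) of
`F0P3cStCharTSPaydown.stub_StSpectralHyp` as a `Prop`, token for token), the index kit `StGlobKit` with its printed laws `LawCountable`, `LawDiscrete`,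
`LawUnitary` (+ the derivation `lawUnitary_of_lawDiscrete` from ★ `isUnitarizable_of_cmOccursInDiscreteSpectrum`), `LawSigns`, `LawFibreFinite`, and the
engine-output letter `E1St1383Letter` (Rogawski's identity (13.8.3) doubled-minus-undoubled and read at the place `v`).  Once this file is in the tree the
workfile `Cruxes/H413/Lines/K2_E1_TraceFormulaBeta.lean` imports it and drops its local copies (statement bytes identical).  The tier-1 socket module
`K2_E1_TraceFormulaBetaSigs_GlobalIndex.lean` names NO local definition (ED. 2) and does not depend on this leaf.
Cell `hodgecm-mathlib`, squad K2, seat K2E1-plan (g0), 2026-09-03.  HONEST LABEL: HC_CM is proved only modulo the 7 printed citations (2 remaining named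
inputs: hLiu418 = `stmt-HodgeConjecture-24832`, h413 = `stmt-HodgeConjecture-24833`) until rung 0 closes; this file proves nothing about them.

References: [Rogawski1990] §12.7 L. 12.7.2 p. 191, §13.8 Prop. 13.8.3 pp. 218–219 (file pages p0184, p0211–p0212 of
`book:rogawski1990-automorphic-representations-unitary-groups-three-variables`); [BorelJacquet1979] §4.6; [Arthur1988InvariantTraceFormulaII] §7.
-/

set_option autoImplicit false
set_option linter.dupNamespace false

noncomputable section

open NumberField IsDedekindDomain MeasureTheory
open scoped Matrix MatrixGroups
open Literature.NumberTheory.Rogawski1990 Literature.NumberTheory.Automorphic Literature.NumberTheory.Automorphic.UnitaryGroup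
open Literature.NumberTheory.Automorphic.UnitaryGroup.CotangentForms Literature.NumberTheory.GaloisRepresentations
open Literature.NumberTheory.Automorphic.Arthur2013.Leaves.TECR
open Summit.HodgeConjecture.HodgeConjecture.Cruxes.H413.F0P3GlobalPacketDiscrete (cmOccursInDiscreteSpectrum isUnitarizable_of_cmOccursInDiscreteSpectrum)

namespace Summit.HodgeConjecture.HodgeConjecture.Cruxes.H413.K2E1TraceFormulaBeta

/-! ## §0 Local currency — reducible copies, byte-identical with `F0P3cStCharTSPaydown.Pl`∕`HLoc`∕`GLoc` (a Theorems leaf cannot import the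
`Cruxes/…/Lines` workfile; both unfold to the same terms, so the tier-0 certificate `example : StSpectralHypLetter := F0P3cStCharTSPaydown.stub_StSpectralHyp`
still elaborates after the re-import) -/

/-- Finite places of `L⁺` (reducible; = `F0P3cStCharTSPaydown.Pl`). [folklore] -/
abbrev Pl (L : Type) [Field L] [NumberField L] [IsCMField L] : Type := HeightOneSpectrum (𝓞 ↥(maximalRealSubfield L))

/-- `H_v = U(Φ₂)(L⁺_v) × U(Φ₁)(L⁺_v)` (reducible; = `F0P3cStCharTSPaydown.HLoc`). [cite: Rogawski1990, §4.9 p. 54] -/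
abbrev HLoc (L : Type) [Field L] [NumberField L] [IsCMField L] (v : Pl L) : Type :=
  (UnitaryGroup.cmDatum L 2 (Matrix.of fun i j : Fin 2 => if i.val + j.val + 1 = 2 then (1 : L) else 0)).Local v ×
    (UnitaryGroup.cmDatum L 1 (Matrix.of fun i j : Fin 1 => if i.val + j.val + 1 = 1 then (1 : L) else 0)).Local v

/-- `G′_v = U(H)(L⁺_v)` (reducible; = `F0P3cStCharTSPaydown.GLoc`). [folklore] -/
abbrev GLoc (L : Type) [Field L] [NumberField L] [IsCMField L] (H : Matrix (Fin 3) (Fin 3) L) (v : Pl L) : Type :=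
  (UnitaryGroup.cmDatum L 3 H).Local v

/-! ## §1 The letter (S-β) as a `Prop` — the statement of `F0P3cStCharTSPaydown.stub_StSpectralHyp` TOKEN FOR TOKEN -/

/-- **THE LETTER (S-β) = hypothesis (β) of [Rogawski1990, Lemma 12.7.2 p. 191] for `ρ = St_H(ξ_v)` on the quasi-split model `U(Φ₃)(L⁺_v)`**, the statement of
the LH6 organ `F0P3cStCharTSPaydown.stub_StSpectralHyp` copied token for token (certificate: the `example` right below).  At a finite place `v` of `L⁺`
non-split in `L`: an integer-valued `aX` on `Irr(U(Φ₃)(L⁺_v))` with countable support and unitarizable members such that for every smooth Δ‴_{Φ₃}-matched pair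
`(f^H, φ)` the series `Σ' aX(π)·Tr π(φ)` converges absolutely to `Tr St_H(ξ_v)(f^H)`.  GLOBAL IN PRINT [§13.8 Props. 13.8.1–13.8.3].
[cite: Rogawski1990, Lemma 12.7.2 p. 191; §13.8 Prop. 13.8.3 (proof) pp. 218–219] -/
def StSpectralHypLetter : Prop :=
  ∀ (L : Type) [Field L] [NumberField L] [IsCMField L] (μ : HeckeCharacter L) (ξ : OneDimAutRepH L) (v : Pl L),
    (∀ w : PlacesOver L v, IsCMField.complexConj L • w.1 = w.1) → μ.IsUnitary →
    (∀ x : Literature.NumberTheory.GaloisRepresentations.ideleGroup ↥(maximalRealSubfield L),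
      μ (AdeleRing.ideleBaseChange (↥(maximalRealSubfield L)) L x) = quadraticHeckeCharCM L x) →
    ∀ [MeasurableSpace (HLoc L v)] [BorelSpace (HLoc L v)] [MeasurableSpace (Gqs L v)] [BorelSpace (Gqs L v)]
      (νHv : Measure (HLoc L v)) (νQv : Measure (Gqs L v))
      [νHv.IsHaarMeasure] [νHv.IsMulRightInvariant] [νQv.IsHaarMeasure] [νQv.IsMulRightInvariant],
    letI : ∀ a : HLoc L v, MeasurableSpace (HLoc L v ⧸ Subgroup.centralizer ({a} : Set (HLoc L v))) := fun _ => borel _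
    haveI : ∀ a : HLoc L v, BorelSpace (HLoc L v ⧸ Subgroup.centralizer ({a} : Set (HLoc L v))) := fun _ => ⟨rfl⟩
    letI : ∀ γ : Gqs L v, MeasurableSpace (Gqs L v ⧸ Subgroup.centralizer ({γ} : Set (Gqs L v))) := fun _ => borel _
    haveI : ∀ γ : Gqs L v, BorelSpace (Gqs L v ⧸ Subgroup.centralizer ({γ} : Set (Gqs L v))) := fun _ => ⟨rfl⟩
    ∀ (mHv : OrbitalMeasureFamily (HLoc L v)) (mQv : OrbitalMeasureFamily (Gqs L v)),
      mHv.IsCanonical (IsLocalGRegular L v) νHv →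
      mQv.IsCanonical (fun γ => IsRegularElt (γ.val : GL (Fin 3) (UnitaryGroup.LocalRing L v))) νQv →
      ∀ (π₁ πSt : IrrClass (HLoc L v)),
        HLengthTwoLabels L v
          (torusCharPair (conjLocal L (IsCMField.complexConj L) v) (cmLocalForm L 2 v) (cmLocalForm_eq_over L 2 v) 0
            ((torusLocalComponent L (IsCMField.complexConj L) v ξ.η).comp
                (quotConj (conjLocal L (IsCMField.complexConj L) v) (conjLocal_conjLocal_cm L v)) *
              halfModulusChar (UnitaryGroup.LocalRing L v))
            (torusLocalComponent L (IsCMField.complexConj L) v ξ.ψ))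
          ((torusLocalComponent L (IsCMField.complexConj L) v ξ.ψ).comp (localDet (IsCMField.complexConj L) v (isUnit_antidiagOne_det L 1))) π₁ πSt →
        (∀ fH : HLoc L v → ℂ, IsLocSmooth fH → π₁.smoothTrace νHv fH = charDist (ξ.xiLocalChar v) νHv fH) →
        ∃ aX : IrrClass (Gqs L v) → ℤ, (Function.support aX).Countable ∧ (∀ π : IrrClass (Gqs L v), aX π ≠ 0 → π.IsUnitarizable) ∧
          ∀ (fH : HLoc L v → ℂ) (φ : Gqs L v → ℂ), IsLocSmooth fH → IsLocSmooth φ →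
            IsLocalDeltaTransfer L (qsForm L) v ((finExplicitCollection L (qsForm L) μ (finExplicitDelta_conj_left_all L (qsForm L) μ) (finExplicitDelta_conj_right_all L (qsForm L) μ)) v) mHv mQv fH φ →
            Summable (fun π : IrrClass (Gqs L v) => (aX π : ℂ) * π.smoothTrace νQv φ) ∧
              ∑' π : IrrClass (Gqs L v), (aX π : ℂ) * π.smoothTrace νQv φ = πSt.smoothTrace νHv fH


/-! ## §2 The index of print's sum (13.8.3) after the choices (G1)(G3)(G4) — OBJECTS ONLY — and the printed LAWS as named `Prop`s -/

/-- **E1's GLOBAL INDEX around `(L⁺_v, ξ_v)`** [Rogawski1990, §13.8 proof of Prop. 13.8.3, pp. 218–219]: after choosing the globalising cuspidal `ρ` of `H` (G1),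
the archimedean test vector (G3) and units away from `v` (G4), the right-hand sum of (13.8.3) runs over the CONTRIBUTING discrete automorphic
representations `π` of `G = U(Φ₃)` over `L⁺` («cuspidal π on G such that ψ_G(t(π)) = t», with `π_∞` in the chosen discrete-series packets and `π_u` unramified
for finite `u ≠ v`).  Fields = objects only: the index type, `m(π)`, the finite local components, the archimedean integer `ε_π`.  Laws are the `Law…`
predicates below; existence is the socket `stub_E1_St1383`. [cite: Rogawski1990, §13.8 display (13.8.3) p. 218, p. 219 line 1] -/
structure StGlobKit (L : Type) [Field L] [NumberField L] [IsCMField L] where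
  /-- the contributing discrete automorphic `π` of `U(Φ₃)(𝔸_{L⁺})` (one index per isomorphism class) -/
  Idx : Type
  /-- `m(π) ∈ ℕ`, the multiplicity of `π` in `L²_disc` [§13.3 p. 199; (13.8.3)] -/
  mult : Idx → ℕ
  /-- the finite local components `π_u ∈ Irr(U(Φ₃)(L⁺_u))` (★ `IrrClass`, ★ `Gqs L u = (cmDatum L 3 Φ₃).Local u`) -/
  loc : Idx → ∀ u : Pl L, IrrClass (Gqs L u)
  /-- `ε_π = Tr π_∞(f_∞) = ±1` for the archimedean test vector of (G3) [p. 219 line 1; Prop. 12.3.2] -/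
  eps : Idx → ℤ

namespace StGlobKit

variable {L : Type} [Field L] [NumberField L] [IsCMField L] (𝔨 : StGlobKit L)

/-- **LAW «COUNTABLE»**: the index is countable (the discrete spectrum of `L²(U(Φ₃)(L⁺)\U(Φ₃)(𝔸_{L⁺}))` is a countable Hilbert sum). [cite: BorelJacquet1979, §4.6] -/
def LawCountable : Prop := Countable 𝔨.Idx

/-- **LAW «DISCRETE»**: every indexed family of finite local components OCCURS IN THE DISCRETE AUTOMORPHIC SPECTRUM of `U(Φ₃)` over `L⁺` (★
`cmOccursInDiscreteSpectrum`, automorphic measure `μG`) with multiplicity `m(π) ≥ 1`. [cite: Rogawski1990, §13.3 p. 199; §13.8 (13.8.3) p. 218] -/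
def LawDiscrete (μG : Measure (adelicGroupData (↥(maximalRealSubfield L)) L (IsCMField.complexConj L) 3 (qsForm L)).automorphicQuotient)
    [(adelicGroupData (↥(maximalRealSubfield L)) L (IsCMField.complexConj L) 3 (qsForm L)).IsAutomorphicMeasure μG] : Prop :=
  ∀ i : 𝔨.Idx, cmOccursInDiscreteSpectrum L 3 (qsForm L) μG (𝔨.loc i) ∧ 0 < 𝔨.mult i

/-- **LAW «UNITARY» (DERIVED, not posited)**: local components of discrete automorphic representations are unitarizable (★ `IrrClass.IsUnitarizable`) —
Prop. 13.8.1's «irreducible unitary representations»; a CONSEQUENCE of «DISCRETE» by ★ `isUnitarizable_of_cmOccursInDiscreteSpectrum` (`lawUnitary_of_lawDiscrete`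
below), hence NOT a conjunct of the socket. [cite: BorelJacquet1979, §4.6] [cite: Rogawski1990, Prop. 13.8.1 p. 213] -/
def LawUnitary : Prop := ∀ (i : 𝔨.Idx) (u : Pl L), (𝔨.loc i u).IsUnitarizable

/-- «DISCRETE» ⇒ «UNITARY» (★ `isUnitarizable_of_cmOccursInDiscreteSpectrum`: the `L²` inner product restricts to the finite component [BorelJacquet1979 §4.6;
Flath Thm. 3]). [cite: BorelJacquet1979, §4.6] -/
theorem lawUnitary_of_lawDiscrete
    (μG : Measure (adelicGroupData (↥(maximalRealSubfield L)) L (IsCMField.complexConj L) 3 (qsForm L)).automorphicQuotient)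
    [(adelicGroupData (↥(maximalRealSubfield L)) L (IsCMField.complexConj L) 3 (qsForm L)).IsAutomorphicMeasure μG]
    (h : 𝔨.LawDiscrete μG) : 𝔨.LawUnitary :=
  fun i u => isUnitarizable_of_cmOccursInDiscreteSpectrum (h i).1 u

/-- **LAW «SIGNS»**: `ε_π = ±1` (the archimedean factor of the contributing `π`: the signs of Prop. 12.3.2 against the pseudo-coefficients of (G3)).
[cite: Rogawski1990, §13.8 p. 219 line 1; Prop. 12.3.2 p. 178] [cite: ClozelDelorme1984, Thm. 1] -/
def LawSigns : Prop := ∀ i : 𝔨.Idx, 𝔨.eps i = 1 ∨ 𝔨.eps i = -1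

/-- **LAW «FINITE FIBRES»** at `v`: for each `π_v` only finitely many contributing global `π` have `v`-component `π_v` (archimedean components in the
chosen finite packets, `π_u = ξ_H(ρ_u)` for finite `u ≠ v` [p. 219], finiteness of automorphic representations with prescribed local data) — what makes
«a(π_w) = Σ m(π) ε_π ∈ ℤ» a finite sum. [cite: Rogawski1990, §13.8 p. 219] [cite: BorelJacquet1979, §4.6] -/
def LawFibreFinite (v : Pl L) : Prop := ∀ π : IrrClass (Gqs L v), {i : 𝔨.Idx | 𝔨.loc i v = π}.Finite

end StGlobKit

/-! ## §3 The ENGINE OUTPUT at `v` and the socket -/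

/-- **E1's LETTER «St-(13.8.3)» — Rogawski's identity (13.8.3) for the globalised `St_H(ξ_v)`, evaluated on the restricted test functions, READ AT `v`.**
Under the prefix of the letter (S-β) VERBATIM (CM field `L`, unitary `μ` restricting to `ω_{L/L⁺}`, `ξ`, a finite place `v` non-split in `L`, Haar measures and
canonical orbital families on `H_v` and `U(Φ₃)(L⁺_v)`, the `H_v`-classes `π₁ = ξ_v` (as a distribution) and `πSt = St_H(ξ_v)` labelled by ★ `HLengthTwoLabels`):
there are an automorphic measure `μG` on `U(Φ₃)(L⁺)\U(Φ₃)(𝔸_{L⁺})` (★ `exists_isAutomorphicMeasure_cmDatum_of_isHermitian` provides one) and an index `𝔨 : StGlobKit L`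
with the laws COUNTABLE · DISCRETE · SIGNS · FINITE FIBRES (UNITARY follows, `lawUnitary_of_lawDiscrete`) such that for every smooth Δ‴_{Φ₃}-matched pair `(f^H, φ)` at `v` (★ `IsLocalDeltaTransfer … (finExplicitCollection …) v mHv mQv f^H φ`):
`Σ'_{π} m(π)·ε_π·Tr π_v(φ)` converges absolutely and equals `Tr St_H(ξ_v)(f^H)` — print's «2Σ m(π)ε_π Tr(π^∞(f^∞)) = 2Tr(ρ^∞((f^∞)^H))» [p. 219] with units
at the finite `u ≠ v` and divided by `2`, i.e. (G1)+(G2)+(G3)+(G4) of the module docstring.  THE ENGINE E1 (GLOBAL, programme-sized): main equality Thm. 10.3.1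
+ Props. 13.5.1∕13.6.1∕13.6.2 + separation by Hecke eigenvalues (Prop. 13.7.1) + Lemma 13.6.3 + (13.8.3) + the globalisation [L₁ p. 227] + Prop. 12.3.2 +
pseudo-coefficients + the fundamental lemma for units.  Strictly stronger than (β) (a GLOBAL signed multiplicity count); not the LH6 head (no finiteness of
the support, no signs pattern, no supercuspidality).
Why it might fail AS TYPED: (1) the tree's Δ‴_{Φ₃} at `v` must be print's transfer factor for `(U(3)_{qs}, H)` up to the `μ`-normalisation of §4.9 (ruling «K»:
`κ ≡ 1` on the quasi-split form) — else `ε_π` cannot absorb the discrepancy uniformly in `(f^H, φ)`; (2) absolute convergence is print's (trace class of the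
cuspidal part on `K`-finite smooth `f`) — asked here for every smooth matched pair at `v` with the away-from-`v` vector FIXED, which is what print uses;
(3) none from the measure: ★ `exists_isAutomorphicMeasure_cmDatum_of_isHermitian` gives an automorphic `μG` on the quasi-split `U(Φ₃)` unconditionally.
[cite: Rogawski1990, §13.8 Prop. 13.8.3 (proof) pp. 218–219, display (13.8.3); §13.7 pp. 211–213; Thm. 10.3.1 p. 157; Lemma 13.6.3; Prop. 12.3.2 p. 178]
[cite: Langlands1980, p. 227; pp. 208–211] [cite: Arthur1988InvariantTraceFormulaII, §7 Cor. 7.3–7.4] [cite: Borel1963, §5] -/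
def E1St1383Letter : Prop :=
  ∀ (L : Type) [Field L] [NumberField L] [IsCMField L] (μ : HeckeCharacter L) (ξ : OneDimAutRepH L) (v : Pl L),
    (∀ w : PlacesOver L v, IsCMField.complexConj L • w.1 = w.1) → μ.IsUnitary →
    (∀ x : Literature.NumberTheory.GaloisRepresentations.ideleGroup ↥(maximalRealSubfield L),
      μ (AdeleRing.ideleBaseChange (↥(maximalRealSubfield L)) L x) = quadraticHeckeCharCM L x) →
    ∀ [MeasurableSpace (HLoc L v)] [BorelSpace (HLoc L v)] [MeasurableSpace (Gqs L v)] [BorelSpace (Gqs L v)]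
      (νHv : Measure (HLoc L v)) (νQv : Measure (Gqs L v))
      [νHv.IsHaarMeasure] [νHv.IsMulRightInvariant] [νQv.IsHaarMeasure] [νQv.IsMulRightInvariant],
    letI : ∀ a : HLoc L v, MeasurableSpace (HLoc L v ⧸ Subgroup.centralizer ({a} : Set (HLoc L v))) := fun _ => borel _
    haveI : ∀ a : HLoc L v, BorelSpace (HLoc L v ⧸ Subgroup.centralizer ({a} : Set (HLoc L v))) := fun _ => ⟨rfl⟩
    letI : ∀ γ : Gqs L v, MeasurableSpace (Gqs L v ⧸ Subgroup.centralizer ({γ} : Set (Gqs L v))) := fun _ => borel _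
    haveI : ∀ γ : Gqs L v, BorelSpace (Gqs L v ⧸ Subgroup.centralizer ({γ} : Set (Gqs L v))) := fun _ => ⟨rfl⟩
    ∀ (mHv : OrbitalMeasureFamily (HLoc L v)) (mQv : OrbitalMeasureFamily (Gqs L v)),
      mHv.IsCanonical (IsLocalGRegular L v) νHv →
      mQv.IsCanonical (fun γ => IsRegularElt (γ.val : GL (Fin 3) (UnitaryGroup.LocalRing L v))) νQv →
      ∀ (π₁ πSt : IrrClass (HLoc L v)),
        HLengthTwoLabels L v
          (torusCharPair (conjLocal L (IsCMField.complexConj L) v) (cmLocalForm L 2 v) (cmLocalForm_eq_over L 2 v) 0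
            ((torusLocalComponent L (IsCMField.complexConj L) v ξ.η).comp
                (quotConj (conjLocal L (IsCMField.complexConj L) v) (conjLocal_conjLocal_cm L v)) *
              halfModulusChar (UnitaryGroup.LocalRing L v))
            (torusLocalComponent L (IsCMField.complexConj L) v ξ.ψ))
          ((torusLocalComponent L (IsCMField.complexConj L) v ξ.ψ).comp (localDet (IsCMField.complexConj L) v (isUnit_antidiagOne_det L 1))) π₁ πSt →
        (∀ fH : HLoc L v → ℂ, IsLocSmooth fH → π₁.smoothTrace νHv fH = charDist (ξ.xiLocalChar v) νHv fH) →
        ∃ (μG : Measure (adelicGroupData (↥(maximalRealSubfield L)) L (IsCMField.complexConj L) 3 (qsForm L)).automorphicQuotient)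
          (_ : (adelicGroupData (↥(maximalRealSubfield L)) L (IsCMField.complexConj L) 3 (qsForm L)).IsAutomorphicMeasure μG)
          (𝔨 : StGlobKit L),
          𝔨.LawCountable ∧ 𝔨.LawDiscrete μG ∧ 𝔨.LawSigns ∧ 𝔨.LawFibreFinite v ∧
          ∀ (fH : HLoc L v → ℂ) (φ : Gqs L v → ℂ), IsLocSmooth fH → IsLocSmooth φ →
            IsLocalDeltaTransfer L (qsForm L) v ((finExplicitCollection L (qsForm L) μ (finExplicitDelta_conj_left_all L (qsForm L) μ) (finExplicitDelta_conj_right_all L (qsForm L) μ)) v) mHv mQv fH φ →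
            Summable (fun i : 𝔨.Idx => (𝔨.mult i : ℂ) * (𝔨.eps i : ℂ) * (𝔨.loc i v).smoothTrace νQv φ) ∧
              ∑' i : 𝔨.Idx, (𝔨.mult i : ℂ) * (𝔨.eps i : ℂ) * (𝔨.loc i v).smoothTrace νQv φ = πSt.smoothTrace νHv fH

end Summit.HodgeConjecture.HodgeConjecture.Cruxes.H413.K2E1TraceFormulaBeta

end
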